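import Mathlib
import HarnessLib
import Literature.MathematicalPhysics.QuantumFieldTheory.U1WardIdentity
import Literature.MathematicalPhysics.QuantumFieldTheory.U1RepUnitaryModel
import Literature.MathematicalPhysics.QuantumFieldTheory.LatticeGaugeProofs
import Summits.QuantumFields.YangMills.Theorems.SoloBlindSinglePlaquette

/-!
# The lattice Bogoliubov inequality for Wilson `U(1)` (Ward identity + Cauchy–Schwarz) — torus engine
# of a parity-free LOWER bound on the plaquette second moment

Route `U1DipoleHelicity` (LINE 4 of the ideator cell ym-idea-2; an abelian COMPARISON line onto the
node `Theorems.U1HelicityGapD4`, not a rung of `YangMills`), helper for the crux item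
stmt-QuantumFields-25881 `Theses.U1DipoleHelicity.WilsonU1PlaquetteSecondMomentD4`
(`|2β⟨sin²θ_{(0;0,1)}⟩_μ − 1| ≤ ε`, "lattice equipartition of the plaquette angle").  Its upper half is
`U1DipoleHelicitySecondMomentUpper`; this file is about the LOWER half, by a mechanism valid on EVERY
torus (no reflection positivity, no parity restriction):

* **Engine — the lattice Bogoliubov inequality** (`sq_plaqCharge_mul_le`): for every integer edge
  charge `c` (test 1-form) with plaquette charges `n_q = (dc)_q` (`plaqCharge`), every torus, every `β`
  and every plaquette `p`,
  `(n_p ⟨cos θ_p⟩)² ≤ β ⟨sin²θ_p⟩ · Σ_q n_q² ⟨cos θ_q⟩`.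
  Proof: the tree's `U(1)` Ward identity (`u1_torus_ward_identity`, integration by parts along the
  phase flow of `c`) applied to `F = sin θ_p` gives `n_p⟨cos θ_p⟩ = β⟨sin θ_p · X_c S⟩`
  (`ward_plaquette_im`), applied to `F = X_c S = Σ_q n_q sin θ_q` gives `Σ_q n_q²⟨cos θ_q⟩ = β⟨(X_c S)²⟩`
  (`ward_actionFlowDeriv`); Cauchy–Schwarz (`sq_integral_mul_le`) closes.
* **The single-edge test form** (`c = 𝟙_{e}`, `e` an edge of `p`; `plaqCharge_edgeIndicator_self`,
  `sum_sq_plaqCharge_edgeIndicator`: `n_p = 1`, `Σ_q n_q² = 2(d−1) = 6` in `d = 4`) gives on every torus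
  of side `≥ 2`: `⟨cos θ_p⟩² ≤ 6β⟨sin²θ_p⟩` (`sq_meanPlaq_le_six_mul`); the limit-state consequence
  `2β⟨sin²θ_{(0;0,1)}⟩_μ ≥ 1/3 − ε` is the companion file `U1DipoleHelicitySecondMomentLower`.
* **What the engine gives with the optimal test form** (recorded, not formalised): maximising
  `n_p²/Σ_q n_q²` over `c` gives the diagonal `P(p,p)` of the `ℓ²`-projection onto exact 2-forms of the
  torus, `= (|Λ| − 1)/(2|Λ|)` by the plane-permutation symmetry of `Σ_{μ<ν}(k̂_μ²+k̂_ν²)/k̂² ≡ 3`; so the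
  engine yields `liminf 2β⟨sin²θ_p⟩_μ ≥ 1`, i.e. the full lower half of the crux, on tori of every
  parity (the boundary test form `c = ∂𝟙_p` already gives `8/9`).  Formalising `P(p,p)` needs the torus
  Fourier transform for 1- and 2-forms or the rank count `rank d₁ = 3(|Λ|−1)`; left to a later file.

Nothing here bears on the Yang–Mills mass gap.
-/

noncomputable section

namespace Summit.QuantumFields.YangMills.Theorems.U1DipoleHelicity

open MeasureTheory Filter Topology Finset
open Literature.MathematicalPhysics.QuantumLattice Literature.MathematicalPhysics.QuantumFieldTheory

/-! ### Cauchy–Schwarz for integrals (discriminant form) -/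

/-- `(∫ X·A)² ≤ (∫ X²)(∫ A²)` for integrable `X·A`, `X²`, `A²`. [folklore] -/
theorem sq_integral_mul_le {Ω : Type*} [MeasurableSpace Ω] (μ : Measure Ω) {X A : Ω → ℝ}
    (hXA : Integrable (fun ω => X ω * A ω) μ) (hX2 : Integrable (fun ω => X ω ^ 2) μ)
    (hA2 : Integrable (fun ω => A ω ^ 2) μ) :
    (∫ ω, X ω * A ω ∂μ) ^ 2 ≤ (∫ ω, X ω ^ 2 ∂μ) * (∫ ω, A ω ^ 2 ∂μ) := by
  have key : ∀ t : ℝ, 0 ≤ (∫ ω, X ω ^ 2 ∂μ) * (t * t) + (-2 * ∫ ω, X ω * A ω ∂μ) * t +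
      ∫ ω, A ω ^ 2 ∂μ := by
    intro t
    have h := integral_nonneg (μ := μ) (f := fun ω => (t * X ω - A ω) ^ 2) fun ω => sq_nonneg _
    have i1 : Integrable (fun ω => t ^ 2 * X ω ^ 2) μ := hX2.const_mul _
    have i2 : Integrable (fun ω => 2 * t * (X ω * A ω)) μ := hXA.const_mul _
    have i12 : Integrable (fun ω => t ^ 2 * X ω ^ 2 - 2 * t * (X ω * A ω)) μ := i1.sub i2
    have hexp : ∫ ω, (t * X ω - A ω) ^ 2 ∂μ =
        t ^ 2 * (∫ ω, X ω ^ 2 ∂μ) - 2 * t * (∫ ω, X ω * A ω ∂μ) + ∫ ω, A ω ^ 2 ∂μ := by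
      calc ∫ ω, (t * X ω - A ω) ^ 2 ∂μ
          = ∫ ω, (t ^ 2 * X ω ^ 2 - 2 * t * (X ω * A ω) + A ω ^ 2) ∂μ :=
            integral_congr_ae (ae_of_all _ fun ω => by ring)
        _ = (∫ ω, (t ^ 2 * X ω ^ 2 - 2 * t * (X ω * A ω)) ∂μ) + ∫ ω, A ω ^ 2 ∂μ :=
            integral_add i12 hA2
        _ = ((∫ ω, t ^ 2 * X ω ^ 2 ∂μ) - ∫ ω, 2 * t * (X ω * A ω) ∂μ) + ∫ ω, A ω ^ 2 ∂μ := by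
            rw [integral_sub i1 i2]
        _ = t ^ 2 * (∫ ω, X ω ^ 2 ∂μ) - 2 * t * (∫ ω, X ω * A ω ∂μ) + ∫ ω, A ω ^ 2 ∂μ := by
            rw [integral_const_mul, integral_const_mul]
    rw [hexp] at h
    linarith
  have hd := discrim_le_zero key
  rw [discrim] at hd
  nlinarith [hd]

/-! ### The Ward identities used -/

section Torus

variable {d L : ℕ} [NeZero L]

/-- Continuous real functions on the `U(1)` configuration torus are integrable for the Wilson state.
[folklore] -/
theorem integrable_wilson_of_continuous (β : ℝ) {H : GaugeConfig d L Circle → ℝ} (hH : Continuous H) :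
    Integrable H (wilsonMeasure (d := d) (L := L) u1Rep β) := by
  haveI := isProbabilityMeasure_wilsonMeasure (d := d) (L := L) (G := Circle) u1Rep continuous_u1Rep β
  exact hH.integrable_of_hasCompactSupport (HasCompactSupport.of_compactSpace H)

omit [NeZero L] in
/-- Continuity of `U ↦ Re U_p`. [folklore] -/
theorem continuous_plaquette_re (x : Site d L) (i j : Fin d) :
    Continuous fun U : GaugeConfig d L Circle => ((plaquetteHolonomy U x i j : Circle) : ℂ).re :=
  Complex.continuous_re.comp (continuous_subtype_val.comp (u1PlaqChar x i j).continuous)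

omit [NeZero L] in
/-- Continuity of `U ↦ Im U_p`. [folklore] -/
theorem continuous_plaquette_im (x : Site d L) (i j : Fin d) :
    Continuous fun U : GaugeConfig d L Circle => ((plaquetteHolonomy U x i j : Circle) : ℂ).im :=
  Complex.continuous_im.comp (continuous_subtype_val.comp (u1PlaqChar x i j).continuous)

/-- **Ward identity for one plaquette sine**: `n_p ⟨cos θ_p⟩_β = β ⟨sin θ_p · X_c S⟩_β`, where
`n_p = (dc)_p` is the plaquette charge of the integer edge charge `c` and `X_c S = Σ_q n_q sin θ_q`.
[folklore] -/
theorem ward_plaquette_im (c : Edge d L → ℤ) (β : ℝ) (x : Site d L) (i j : Fin d) :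
    wilsonExpectation u1Rep β (fun U : GaugeConfig d L Circle =>
        (plaqCharge c x i j : ℝ) * ((plaquetteHolonomy U x i j : Circle) : ℂ).re) =
      β * wilsonExpectation u1Rep β (fun U : GaugeConfig d L Circle =>
        ((plaquetteHolonomy U x i j : Circle) : ℂ).im * actionFlowDeriv c U) := by
  refine u1_torus_ward_identity c β (continuous_plaquette_im x i j)
    (continuous_const.mul (continuous_plaquette_re x i j)) fun U t => ?_
  simp only [plaquetteHolonomy_phaseFlow]
  exact hasDerivAt_coe_exp_mul_im _ _ _

/-- **Ward identity for the action derivative**: `Σ_q n_q² ⟨cos θ_q⟩_β = β ⟨(X_c S)²⟩_β`. [folklore] -/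
theorem ward_actionFlowDeriv (c : Edge d L → ℤ) (β : ℝ) :
    wilsonExpectation u1Rep β (fun U : GaugeConfig d L Circle => ∑ q : Plaquette d L,
        (plaqCharge c q.1 q.2.1.1 q.2.1.2 : ℝ) ^ 2 *
          ((plaquetteHolonomy U q.1 q.2.1.1 q.2.1.2 : Circle) : ℂ).re) =
      β * wilsonExpectation u1Rep β (fun U : GaugeConfig d L Circle =>
        actionFlowDeriv c U * actionFlowDeriv c U) := by
  refine u1_torus_ward_identity c β (continuous_actionFlowDeriv c)
    (continuous_finsetSum _ fun q _ => continuous_const.mul (continuous_plaquette_re _ _ _))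
    fun U t => ?_
  simp only [actionFlowDeriv, plaquetteHolonomy_phaseFlow]
  refine HasDerivAt.fun_sum fun q _ => ?_
  have h := (hasDerivAt_coe_exp_mul_im (plaqCharge c q.1 q.2.1.1 q.2.1.2 : ℝ)
    (plaquetteHolonomy U q.1 q.2.1.1 q.2.1.2) t).const_mul (plaqCharge c q.1 q.2.1.1 q.2.1.2 : ℝ)
  refine h.congr_deriv ?_
  ring

/-- **The lattice Bogoliubov inequality** for Wilson `U(1)` on a torus: for every integer edge charge
`c`, every `β` and every plaquette `p = (x; i, j)`,
`(n_p ⟨cos θ_p⟩)² ≤ β ⟨sin² θ_p⟩ · Σ_q n_q² ⟨cos θ_q⟩` (`n_q = (dc)_q`): the two Ward identities and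
Cauchy–Schwarz.  Maximised over `c` the right constant is the diagonal of the projection onto exact
2-forms (see the file header). [folklore] -/
theorem sq_plaqCharge_mul_le (c : Edge d L → ℤ) (β : ℝ) (x : Site d L) (i j : Fin d) :
    ((plaqCharge c x i j : ℝ) * wilsonExpectation u1Rep β
        (fun U : GaugeConfig d L Circle => ((plaquetteHolonomy U x i j : Circle) : ℂ).re)) ^ 2 ≤
      β * wilsonExpectation u1Rep β
          (fun U : GaugeConfig d L Circle => ((plaquetteHolonomy U x i j : Circle) : ℂ).im ^ 2) *
        wilsonExpectation u1Rep β (fun U : GaugeConfig d L Circle => ∑ q : Plaquette d L,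
          (plaqCharge c q.1 q.2.1.1 q.2.1.2 : ℝ) ^ 2 *
            ((plaquetteHolonomy U q.1 q.2.1.1 q.2.1.2 : Circle) : ℂ).re) := by
  have h1 := ward_plaquette_im c β x i j
  have h2 := ward_actionFlowDeriv c β
  have hn : (plaqCharge c x i j : ℝ) * wilsonExpectation u1Rep β
      (fun U : GaugeConfig d L Circle => ((plaquetteHolonomy U x i j : Circle) : ℂ).re) =
      wilsonExpectation u1Rep β (fun U : GaugeConfig d L Circle =>
        (plaqCharge c x i j : ℝ) * ((plaquetteHolonomy U x i j : Circle) : ℂ).re) := by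
    simp only [wilsonExpectation]
    rw [integral_const_mul]
  -- Cauchy–Schwarz for `X = sin θ_p`, `A = X_c S`
  have hCS := sq_integral_mul_le (wilsonMeasure (d := d) (L := L) u1Rep β)
    (X := fun U : GaugeConfig d L Circle => ((plaquetteHolonomy U x i j : Circle) : ℂ).im)
    (A := actionFlowDeriv c)
    (integrable_wilson_of_continuous β ((continuous_plaquette_im x i j).mul (continuous_actionFlowDeriv c)))
    (integrable_wilson_of_continuous β ((continuous_plaquette_im x i j).pow 2))
    (integrable_wilson_of_continuous β ((continuous_actionFlowDeriv c).pow 2))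
  rw [hn, h1, h2]
  simp only [wilsonExpectation] at hCS ⊢
  have hsq : ∫ U, actionFlowDeriv c U * actionFlowDeriv c U ∂wilsonMeasure u1Rep β =
      ∫ U, actionFlowDeriv c U ^ 2 ∂wilsonMeasure u1Rep β := by
    refine integral_congr_ae (ae_of_all _ fun U => ?_); simp only [sq]
  rw [hsq]
  have hβ : 0 ≤ β ^ 2 := sq_nonneg β
  calc (β * ∫ U, ((plaquetteHolonomy U x i j : Circle) : ℂ).im * actionFlowDeriv c U
          ∂wilsonMeasure u1Rep β) ^ 2
      = β ^ 2 * (∫ U, ((plaquetteHolonomy U x i j : Circle) : ℂ).im * actionFlowDeriv c U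
          ∂wilsonMeasure u1Rep β) ^ 2 := by ring
    _ ≤ β ^ 2 * ((∫ U, ((plaquetteHolonomy U x i j : Circle) : ℂ).im ^ 2 ∂wilsonMeasure u1Rep β) *
          ∫ U, actionFlowDeriv c U ^ 2 ∂wilsonMeasure u1Rep β) :=
        mul_le_mul_of_nonneg_left hCS hβ
    _ = β * (∫ U, ((plaquetteHolonomy U x i j : Circle) : ℂ).im ^ 2 ∂wilsonMeasure u1Rep β) *
          (β * ∫ U, actionFlowDeriv c U ^ 2 ∂wilsonMeasure u1Rep β) := by ring

/-! ### The single-edge test form -/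

omit [NeZero L] in
/-- The indicator charge of one edge. [folklore] -/
theorem plaqCharge_edgeIndicator (e₀ : Edge d L) (y : Site d L) (k l : Fin d) :
    plaqCharge (fun e => if e = e₀ then (1 : ℤ) else 0) y k l =
      (if (y, k) = e₀ then 1 else 0) + (if (y.shift k, l) = e₀ then 1 else 0) -
        (if (y.shift l, k) = e₀ then 1 else 0) - (if (y, l) = e₀ then 1 else 0) := rfl

omit [NeZero L] in
/-- On a torus of side `≥ 2` a unit shift moves every site. [folklore] -/
theorem shift_ne_self [Fact (1 < L)] (y : Site d L) (k : Fin d) : y.shift k ≠ y := by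
  intro h
  have h1 := congrFun h k
  simp only [Site.shift, Pi.add_apply, Pi.single_eq_same, add_eq_left] at h1
  exact one_ne_zero h1

omit [NeZero L] in
/-- The plaquette `(x; i, j)`, `i ≠ j`, carries charge `1` under the indicator of its edge `(x, i)`
(torus side `≥ 2`). [folklore] -/
theorem plaqCharge_edgeIndicator_self [Fact (1 < L)] (x : Site d L) {i j : Fin d} (hij : i ≠ j) :
    plaqCharge (fun e => if e = (x, i) then (1 : ℤ) else 0) x i j = 1 := by
  rw [plaqCharge_edgeIndicator]
  have h2 : ((x.shift i, j) = (x, i)) = False := by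
    rw [eq_iff_iff, iff_false]; intro h; exact hij (Prod.mk.inj h).2.symm
  have h3 : ((x.shift j, i) = (x, i)) = False := by
    rw [eq_iff_iff, iff_false]; intro h; exact shift_ne_self x j (Prod.mk.inj h).1
  have h4 : ((x, j) = (x, i)) = False := by
    rw [eq_iff_iff, iff_false]; intro h; exact hij (Prod.mk.inj h).2.symm
  simp [h2, h3, h4]

/-- **The single-edge count**, `d = 4`: `Σ_q (d𝟙_{(x,0)})_q² = 6` — the six plaquettes containing the
edge `(x, 0)` each carry charge `±1` (torus side `≥ 2`). [folklore] -/
theorem sum_sq_plaqCharge_edgeIndicator {L : ℕ} [NeZero L] [Fact (1 < L)] (x : Site 4 L) :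
    ∑ q : Plaquette 4 L,
      ((plaqCharge (fun e => if e = (x, (0 : Fin 4)) then (1 : ℤ) else 0) q.1 q.2.1.1 q.2.1.2 : ℤ) : ℝ) ^ 2
        = 6 := by
  -- split the sum over base points and (ordered) planes, planes first
  rw [Fintype.sum_prod_type, Finset.sum_comm]
  -- for a plane `(k, l)`, `k < l`: the base-point sum is `2` if `k = 0` and `0` otherwise
  have hplane : ∀ kl : {p : Fin 4 × Fin 4 // p.1 < p.2},
      ∑ y : Site 4 L, ((plaqCharge (fun e => if e = (x, (0 : Fin 4)) then (1 : ℤ) else 0)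
          y kl.1.1 kl.1.2 : ℤ) : ℝ) ^ 2 = if kl.1.1 = 0 then 2 else 0 := by
    rintro ⟨⟨k, l⟩, hkl⟩
    have hl0 : l ≠ 0 := fun h => by simp [h] at hkl
    simp only
    by_cases hk : k = 0
    · subst hk
      rw [if_pos rfl]
      -- `n_{(y;0,l)} = [y = x] − [y + e_l = x]`
      have hn : ∀ y : Site 4 L, ((plaqCharge (fun e => if e = (x, (0 : Fin 4)) then (1 : ℤ) else 0)
          y 0 l : ℤ) : ℝ) = (if y = x then 1 else 0) - (if y.shift l = x then 1 else 0) := by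
        intro y
        rw [plaqCharge_edgeIndicator]
        have h2 : ((y.shift 0, l) = (x, (0 : Fin 4))) = False := by
          rw [eq_iff_iff, iff_false]; intro h; exact hl0 (Prod.mk.inj h).2
        have h4 : ((y, l) = (x, (0 : Fin 4))) = False := by
          rw [eq_iff_iff, iff_false]; intro h; exact hl0 (Prod.mk.inj h).2
        simp only [Prod.mk.injEq, and_true, h2, h4, if_false]
        push_cast
        ring
      simp_rw [hn]
      -- the two indicator functions have disjoint singleton supports
      have hsq : ∀ y : Site 4 L, ((if y = x then (1 : ℝ) else 0) - (if y.shift l = x then 1 else 0)) ^ 2 =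
          (if y = x then (1 : ℝ) else 0) + (if y = x - Pi.single l 1 then 1 else 0) := by
        intro y
        have hshift : (y.shift l = x) ↔ (y = x - Pi.single l 1) := by
          rw [Site.shift]; constructor <;> intro h <;> [rw [← h]; rw [h]] <;> simp
        by_cases hy : y = x
        · have hne : ¬ (y = x - Pi.single l 1) := by
            intro h
            have := shift_ne_self (x - Pi.single l 1) l
            rw [Site.shift, sub_add_cancel] at this
            exact this (hy.symm.trans h)
          have hne' : ¬ (y.shift l = x) := by rw [hy]; exact shift_ne_self x l
          rw [if_pos hy, if_neg hne, if_neg hne']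
          norm_num
        · by_cases hy' : y = x - Pi.single l 1
          · have h' : y.shift l = x := hshift.2 hy'
            rw [if_neg hy, if_pos hy', if_pos h']
            norm_num
          · have h' : ¬ (y.shift l = x) := fun h => hy' (hshift.1 h)
            rw [if_neg hy, if_neg hy', if_neg h']
            norm_num
      simp_rw [hsq]
      rw [Finset.sum_add_distrib, Finset.sum_ite_eq' Finset.univ x, Finset.sum_ite_eq' Finset.univ]
      simp
      norm_num
    · rw [if_neg hk]
      refine Finset.sum_eq_zero fun y _ => ?_
      rw [plaqCharge_edgeIndicator]
      have h1 : ((y, k) = (x, (0 : Fin 4))) = False := by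
        rw [eq_iff_iff, iff_false]; intro h; exact hk (Prod.mk.inj h).2
      have h2 : ((y.shift k, l) = (x, (0 : Fin 4))) = False := by
        rw [eq_iff_iff, iff_false]; intro h; exact hl0 (Prod.mk.inj h).2
      have h3 : ((y.shift l, k) = (x, (0 : Fin 4))) = False := by
        rw [eq_iff_iff, iff_false]; intro h; exact hk (Prod.mk.inj h).2
      have h4 : ((y, l) = (x, (0 : Fin 4))) = False := by
        rw [eq_iff_iff, iff_false]; intro h; exact hl0 (Prod.mk.inj h).2
      simp [h1, h2, h3, h4]
  rw [Finset.sum_congr rfl fun kl _ => hplane kl]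
  -- three planes contain the direction `0`
  rw [Finset.sum_ite, Finset.sum_const_zero, add_zero, Finset.sum_const, nsmul_eq_mul]
  have hcard : (Finset.univ.filter (fun kl : {p : Fin 4 × Fin 4 // p.1 < p.2} => kl.1.1 = 0)).card = 3 := by
    decide
  rw [hcard]
  norm_num

/-- All plaquettes of the torus have the same mean cosine (lattice symmetries; tree
`SoloBlind.wilsonExpectation_plaquetteCost_eq`). [folklore] -/
theorem wilsonExpectation_plaquette_re_eq (β : ℝ) (q : Plaquette d L) (x : Site d L) {i j : Fin d}
    (hij : i ≠ j) :
    wilsonExpectation u1Rep β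
        (fun U : GaugeConfig d L Circle => ((plaquetteHolonomy U q.1 q.2.1.1 q.2.1.2 : Circle) : ℂ).re) =
      wilsonExpectation u1Rep β
        (fun U : GaugeConfig d L Circle => ((plaquetteHolonomy U x i j : Circle) : ℂ).re) := by
  have h1 := SoloBlind.wilsonExpectation_plaquetteCost_eq u1Rep continuous_u1Rep β q.1
    (ne_of_lt q.2.2) hij
  have h2 := SoloBlind.wilsonExpectation_plaquetteCost_eq u1Rep continuous_u1Rep β x hij hij
  haveI := isProbabilityMeasure_wilsonMeasure (d := d) (L := L) (G := Circle) u1Rep continuous_u1Rep β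
  have hsub : ∀ (y : Site d L) (k l : Fin d),
      wilsonExpectation u1Rep β (SoloBlind.plaquetteCost u1Rep y k l) =
      1 - wilsonExpectation u1Rep β
        (fun U : GaugeConfig d L Circle => ((plaquetteHolonomy U y k l : Circle) : ℂ).re) := by
    intro y k l
    simp only [wilsonExpectation, SoloBlind.plaquetteCost, trace_u1Rep_re, Nat.cast_one]
    rw [integral_sub (integrable_const _)
      (integrable_wilson_of_continuous β (continuous_plaquette_re y k l)),
      integral_const, probReal_univ, one_smul]
  rw [hsub, hsub] at h1 h2
  linarith

/-- **Single-edge Bogoliubov bound on a torus** (`d = 4`, side `≥ 2`, any `β ≥ 0`):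
`⟨cos θ_{(x;0,1)}⟩² ≤ 6 β ⟨sin² θ_{(x;0,1)}⟩`. [folklore] -/
theorem sq_meanPlaq_le_six_mul {L : ℕ} [NeZero L] [Fact (1 < L)] {β : ℝ} (hβ : 0 ≤ β) (x : Site 4 L) :
    (wilsonExpectation u1Rep β
        (fun U : GaugeConfig 4 L Circle => ((plaquetteHolonomy U x 0 1 : Circle) : ℂ).re)) ^ 2 ≤
      6 * (β * wilsonExpectation u1Rep β
        (fun U : GaugeConfig 4 L Circle => ((plaquetteHolonomy U x 0 1 : Circle) : ℂ).im ^ 2)) := by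
  set c : Edge 4 L → ℤ := fun e => if e = (x, (0 : Fin 4)) then (1 : ℤ) else 0 with hc
  set m : ℝ := wilsonExpectation u1Rep β
    (fun U : GaugeConfig 4 L Circle => ((plaquetteHolonomy U x 0 1 : Circle) : ℂ).re) with hm
  have h := sq_plaqCharge_mul_le c β x 0 1
  have hn : (plaqCharge c x 0 1 : ℝ) = 1 := by
    rw [hc, plaqCharge_edgeIndicator_self x (by decide : (0 : Fin 4) ≠ 1)]; norm_num
  rw [hn, one_mul] at h
  -- the weighted count `Σ_q n_q² ⟨cos θ_q⟩ = 6 m ≤ 6 |m|`-free: every plaquette has mean cosine `m`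
  have hsum : wilsonExpectation u1Rep β (fun U : GaugeConfig 4 L Circle => ∑ q : Plaquette 4 L,
      (plaqCharge c q.1 q.2.1.1 q.2.1.2 : ℝ) ^ 2 *
        ((plaquetteHolonomy U q.1 q.2.1.1 q.2.1.2 : Circle) : ℂ).re) = 6 * m := by
    simp only [wilsonExpectation]
    rw [integral_finsetSum _ fun q _ =>
      (integrable_wilson_of_continuous β (continuous_plaquette_re q.1 q.2.1.1 q.2.1.2)).const_mul _]
    have hq : ∀ q : Plaquette 4 L, ∫ U, (plaqCharge c q.1 q.2.1.1 q.2.1.2 : ℝ) ^ 2 *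
        ((plaquetteHolonomy U q.1 q.2.1.1 q.2.1.2 : Circle) : ℂ).re ∂wilsonMeasure u1Rep β =
        (plaqCharge c q.1 q.2.1.1 q.2.1.2 : ℝ) ^ 2 * m := by
      intro q
      rw [integral_const_mul]
      congr 1
      exact wilsonExpectation_plaquette_re_eq β q x (by decide : (0 : Fin 4) ≠ 1)
    simp_rw [hq]
    rw [← Finset.sum_mul, hc, sum_sq_plaqCharge_edgeIndicator x]
  rw [hsum] at h
  -- `m² ≤ β ⟨sin²⟩ · 6 m`-shaped: h : m ^ 2 ≤ β * S * (6 * m)`; conclude `m² ≤ 6 β S` from `m ≤ 1`, `β S ≥ 0`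
  have hS : 0 ≤ wilsonExpectation u1Rep β
      (fun U : GaugeConfig 4 L Circle => ((plaquetteHolonomy U x 0 1 : Circle) : ℂ).im ^ 2) := by
    simp only [wilsonExpectation]; exact integral_nonneg fun U => sq_nonneg _
  have hm1 : m ≤ 1 := by
    haveI := isProbabilityMeasure_wilsonMeasure (d := 4) (L := L) (G := Circle) u1Rep continuous_u1Rep β
    rw [hm]; simp only [wilsonExpectation]
    calc ∫ U, ((plaquetteHolonomy U x 0 1 : Circle) : ℂ).re ∂wilsonMeasure u1Rep β
        ≤ ∫ _U, (1 : ℝ) ∂wilsonMeasure u1Rep β :=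
          integral_mono (integrable_wilson_of_continuous β (continuous_plaquette_re x 0 1))
            (integrable_const _) fun U => (Complex.re_le_norm _).trans (le_of_eq (Circle.norm_coe _))
      _ = 1 := by simp
  by_cases hm0 : 0 ≤ m
  · nlinarith [mul_nonneg hβ hS]
  · -- `m < 0`: then `β S · 6m ≤ 0`, so `h` forces `m = 0`-sized bounds; conclude with `β S ≥ 0`
    have hm0 : m < 0 := lt_of_not_ge hm0
    have : β * wilsonExpectation u1Rep β
        (fun U : GaugeConfig 4 L Circle => ((plaquetteHolonomy U x 0 1 : Circle) : ℂ).im ^ 2) *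
        (6 * m) ≤ 0 := mul_nonpos_of_nonneg_of_nonpos (mul_nonneg hβ hS) (by linarith)
    nlinarith [sq_nonneg m]

end Torus

end Summit.QuantumFields.YangMills.Theorems.U1DipoleHelicity
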